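import Summits.QuantumFields.YangMills.Theorems.BalabanUVNodesN15SmallFieldAxialGaugeTransporterLetterUN
import HarnessLib

/-!
# Route «BalabanUVNodes» (cluster K4 «SpineRates»), Track-A DAG node N15 = NE2, BACKGROUND LAYER — THE `SU(N)` EDITION OF THE SMALL-FIELD AXIAL-GAUGE JUNCTION: plaquette-small `SU(N)`
# configuration on a non-wrapping box ⟹ in the axial gauge every bond variable has `‖U^u(b) − 1‖_F ≤ √|n|·(d − 1)Nδ` and dag-n15-w3 file 1's entrywise transporter letter
# `|S(b) − 1|_{ij} ≤ κ_e·2|n|·(d − 1)Nδ` for `S(b) = coordMat e (Ad_{U^u(b)})` (the cell's `instGaugeGroupSpecialUnitaryGroup`: `dist1 g = ‖g − 1‖_{op}` on the same matrix, `rfl`)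

Cell `pub-ymgap`, seat `pub-ymgap-dag-n15-w2` (WIDTH SEAT 2∕3 on node N15, director-ym №197 ∕ HUMAN RULING D-0149), g5, twelfth piece (bus CLAIM-12) — FILES 3∕4 at the Yang–Mills gauge
group `SU(N)` (B12 Thm 2's group).  `bears_on: R4∕N15 · K3⁸ SpineGivenEndpointR13SepCoPHV (stmt-QuantumFields-27366)`.  Filed `--kind proof --supports stmt-QuantumFields-27366 --as helper` —
COUNT-NEUTRAL.  Theorems only; 0 `def`, 0 `sorry`.  Imports BY NAME this seat's FILE 4 `…SmallFieldAxialGaugeTransporterLetterUN` (through it FILE 3 `frobenius_norm_le_sqrt_card_mul_l2_opNorm`,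
FILE 2 `uN_abs_coordMat_conj_sub_entry_le` ∕ `coordMat_conj_one`, g2 `uN_coordMat_conj_orthogonal`, pub-balaban `T4AxialGaugeSmallField` ∕ `T4SmallFieldWindowSandwich` ∕ `UnitaryModel`
(`instGaugeGroupSpecialUnitaryGroup`)); nothing in the tree is modified, no landed name re-declared.

WHY.  The Yang–Mills gauge group of the programme is `SU(N)` (the cell's `UnitaryModel.instGaugeGroupSpecialUnitaryGroup`, `dist1` = L²-operator norm of `g − 1` through the fundamental
representation — definitionally the same matrix quantity as for `U(N)`).  FILES 3∕4 were typed at `U(N)`; every step is a statement about the underlying unitary matrix, so the `SU(N)`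
edition is the same chain read on `Matrix.specialUnitaryGroup n ℂ`:
* §1 `suN_coe_conjTranspose_mul_self`, ★ `suN_frobenius_norm_sub_one_le_of_dist1` (`‖U − 1‖_F ≤ √|n|·dist1 U`), ★ `suN_transporterLetter_of_dist1`
  (`|(coordMat e (Ad_U) − 1)_{ij}| ≤ κ_e·(2|n|)·dist1 U`);
* §2 ★★★ `suN_frobenius_gaugeAct_axialGauge_le_of_mem_boxBonds`, ★★★ `suN_transporterLetter_gaugeAct_axialGauge_of_mem_boxBonds`, ★★ `suN_exists_gauge_transporterLetter_of_plaqSmallOn`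
  (orthogonality ∧ letter on all box bonds), A6 `suN_exists_gauge_transporterLetter_one`.

HONEST FRAMING ∕ LIMITS.  Same as FILES 3∕4: only the FIRST inequality of (3.35) p. 396 (sup letter); the second is NOT produced; box only, non-wrapping; crude constants; group level.  Nothing
of [B5]∕[B6]∕[B9]∕[Balaban1985Averaging] asserted beyond cited shapes; NE2⁺ NOT PRINTED ∕ NOT proved; N15 NOT discharged; K3⁸ OPEN, skeleton v6 untouched; counts of record UNMOVED (typed 28∕28 ·
discharged 5∕27 · A 5∕28); one finite 𝕋⁴ at fixed ε — NOT ℝ⁴ ∕ OS ∕ mass gap ∕ Clay; R4 closes the conditional finite-𝕋⁴ rung `BalabanLadder.UV` only.  Restate-immune (no Theses import).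
-/

set_option autoImplicit false

noncomputable section
open scoped BigOperators Matrix Matrix.Norms.Frobenius

namespace Summit.QuantumFields.YangMills.BalabanUVNodes.N15.CurvedSpecies

open Literature.MathematicalPhysics.QuantumFieldTheory.Balaban1983to89
open Literature.MathematicalPhysics.QuantumFieldTheory.Balaban1983to89.T4AxialGaugeSmallField
open Literature.MathematicalPhysics.QuantumFieldTheory.Balaban1983to89.T4SmallFieldWindowSandwich (plaqSmallOn_one)
open Summit.QuantumFields.YangMills.BalabanUVNodes.N15.MatrixSpecies (coordMat basisConst basisConst_nonneg)
open Literature.Barriers.QuantumFields (traceForm)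

variable {n : Type} [Fintype n] [DecidableEq n] {κ : Type} [Fintype κ] [DecidableEq κ] (e : Matrix n n ℂ ≃L[ℝ] (κ → ℝ))

/-! ## §1 `SU(n)`: unitarity, the Frobenius letter and the transporter letter from `dist1` -/

omit [Fintype n] in
/-- `UᴴU = 1` for `U ∈ SU(n)`. [folklore] -/
theorem suN_coe_conjTranspose_mul_self [Fintype n] (U : Matrix.specialUnitaryGroup n ℂ) : (U : Matrix n n ℂ)ᴴ * (U : Matrix n n ℂ) = 1 :=
  Matrix.mem_unitaryGroup_iff'.mp (Matrix.mem_specialUnitaryGroup_iff.mp U.2).1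

variable [Nonempty n]

/-- ★ **`‖U − 1‖_F ≤ √|n|·dist1 U` on `SU(n)`** (the cell's instance reads `dist1 U = ‖U − 1‖_{op}` on the same matrix, `rfl`; FILE 3 `frobenius_norm_le_sqrt_card_mul_l2_opNorm`).
[cite: Balaban1985Averaging, (19) p.21] -/
theorem suN_frobenius_norm_sub_one_le_of_dist1 (U : Matrix.specialUnitaryGroup n ℂ) : ‖(U : Matrix n n ℂ) - 1‖ ≤ Real.sqrt (Fintype.card n) * dist1 U :=
  frobenius_norm_le_sqrt_card_mul_l2_opNorm ((U : Matrix n n ℂ) - 1)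

/-- ★ **`dist1` CONTROLS THE TRANSPORTER LETTER ON `SU(n)`**: `|(coordMat e (Ad_U) − 1)_{ij}| ≤ κ_e·(2|n|)·dist1 U`. [cite: Balaban1985BackgroundPropagators, (3.35)∕(3.37) p.396 (shape); Balaban1985Averaging, (19) p.21] -/
theorem suN_transporterLetter_of_dist1 (U : Matrix.specialUnitaryGroup n ℂ) (i j : κ) :
    |(coordMat e (ContinuousLinearMap.mulLeftRight ℝ (Matrix n n ℂ) (U : Matrix n n ℂ) (U : Matrix n n ℂ)ᴴ) - 1) i j| ≤ basisConst e * (2 * Fintype.card n) * dist1 U := by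
  have h1 : (1 : Matrix n n ℂ)ᴴ * 1 = 1 := by rw [Matrix.conjTranspose_one, Matrix.mul_one]
  have hn : Real.sqrt (Fintype.card n) * Real.sqrt (Fintype.card n) = Fintype.card n := Real.mul_self_sqrt (Nat.cast_nonneg _)
  rw [← coordMat_conj_one e]
  calc _ ≤ basisConst e * (2 * Real.sqrt (Fintype.card n) * ‖(U : Matrix n n ℂ) - 1‖) := uN_abs_coordMat_conj_sub_entry_le e h1 (suN_coe_conjTranspose_mul_self U) i j
    _ ≤ basisConst e * (2 * Real.sqrt (Fintype.card n) * (Real.sqrt (Fintype.card n) * dist1 U)) := by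
        gcongr; exacts [basisConst_nonneg e, suN_frobenius_norm_sub_one_le_of_dist1 U]
    _ = basisConst e * (2 * (Real.sqrt (Fintype.card n) * Real.sqrt (Fintype.card n))) * dist1 U := by ring
    _ = basisConst e * (2 * Fintype.card n) * dist1 U := by rw [hn]

/-! ## §2 The junction on a plaquette-small non-wrapping box, `G = SU(N)` -/

variable {P : Params} {j : ℕ}

/-- ★★★ **PLAQUETTE-SMALL `SU(N)` CONFIGURATION ⟹ AXIAL-GAUGE BOND VARIABLES FROBENIUS-CLOSE TO `1`**: `‖U^u(b) − 1‖_F ≤ √|n|·((d − 1)·N·δ)` on every box bond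
(pub-balaban `dist1_gaugeAct_axialGauge_le_of_mem_boxBonds` at `SU(N)` + §1). [cite: Balaban1985BackgroundPropagators, (3.35) p.396 (first inequality: shape); Balaban1985Averaging, (19) p.21] -/
theorem suN_frobenius_gaugeAct_axialGauge_le_of_mem_boxBonds (U : GaugeField P j (Matrix.specialUnitaryGroup n ℂ)) {lo hi : Fin P.d → ℤ} {δ : ℝ} {S₀ : Set (Plaq P j)} {N : ℕ}
    (hS₀ : boxPlaqs lo hi ⊆ S₀) (hU : PlaqSmallOn S₀ δ U) (hδ : 0 ≤ δ) (hn : ∀ k, hi k ≤ lo k + N) (hnN : N < P.sitesPerDir j) {b : PBond P j} (hb : b ∈ boxBonds lo hi) :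
    ‖((GaugeField.gaugeAct (axialGauge U lo hi) U b : Matrix.specialUnitaryGroup n ℂ) : Matrix n n ℂ) - 1‖ ≤ Real.sqrt (Fintype.card n) * (((P.d - 1 : ℕ) : ℝ) * N * δ) :=
  (suN_frobenius_norm_sub_one_le_of_dist1 _).trans
    (mul_le_mul_of_nonneg_left (dist1_gaugeAct_axialGauge_le_of_mem_boxBonds U hS₀ hU hδ hn hnN hb) (Real.sqrt_nonneg _))

/-- ★★★ **PLAQUETTE-SMALL `SU(N)` CONFIGURATION ⟹ THE TRANSPORTER LETTER ON EVERY BOX BOND**: `|(coordMat e (Ad_{U^u(b)}) − 1)_{ij}| ≤ κ_e·(2|n|)·((d − 1)·N·δ)`.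
[cite: Balaban1985BackgroundPropagators, (3.35) p.396 (first inequality: shape); Balaban1985Averaging, (19) p.21] -/
theorem suN_transporterLetter_gaugeAct_axialGauge_of_mem_boxBonds (U : GaugeField P j (Matrix.specialUnitaryGroup n ℂ)) {lo hi : Fin P.d → ℤ} {δ : ℝ} {S₀ : Set (Plaq P j)} {N : ℕ}
    (hS₀ : boxPlaqs lo hi ⊆ S₀) (hU : PlaqSmallOn S₀ δ U) (hδ : 0 ≤ δ) (hn : ∀ k, hi k ≤ lo k + N) (hnN : N < P.sitesPerDir j) {b : PBond P j} (hb : b ∈ boxBonds lo hi) (i i' : κ) :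
    |(coordMat e (ContinuousLinearMap.mulLeftRight ℝ (Matrix n n ℂ) ((GaugeField.gaugeAct (axialGauge U lo hi) U b : Matrix.specialUnitaryGroup n ℂ) : Matrix n n ℂ)
        ((GaugeField.gaugeAct (axialGauge U lo hi) U b : Matrix.specialUnitaryGroup n ℂ) : Matrix n n ℂ)ᴴ) - 1) i i'| ≤
      basisConst e * (2 * Fintype.card n) * (((P.d - 1 : ℕ) : ℝ) * N * δ) :=
  (suN_transporterLetter_of_dist1 e _ i i').trans
    (mul_le_mul_of_nonneg_left (dist1_gaugeAct_axialGauge_le_of_mem_boxBonds U hS₀ hU hδ hn hnN hb) (mul_nonneg (basisConst_nonneg e) (by positivity)))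

/-- ★★ **∃-FORM AT `SU(N)`**: a gauge transformation `u` such that on every box bond `S(b) = coordMat e (Ad_{U^u(b)})` is orthogonal on both sides and satisfies the letter.
[cite: Balaban1985BackgroundPropagators, (3.35) p.396 (shape), (3.50) p.400; Balaban1985Averaging, (19) p.21] -/
theorem suN_exists_gauge_transporterLetter_of_plaqSmallOn (he : ∀ A B : Matrix n n ℂ, traceForm A B = e A ⬝ᵥ e B) (U : GaugeField P j (Matrix.specialUnitaryGroup n ℂ))
    {lo hi : Fin P.d → ℤ} {δ : ℝ} {S₀ : Set (Plaq P j)} {N : ℕ} (hS₀ : boxPlaqs lo hi ⊆ S₀) (hU : PlaqSmallOn S₀ δ U) (hδ : 0 ≤ δ) (hn : ∀ k, hi k ≤ lo k + N)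
    (hnN : N < P.sitesPerDir j) :
    ∃ u : GaugeTransf P j (Matrix.specialUnitaryGroup n ℂ), ∀ b ∈ boxBonds lo hi,
      coordMat e (ContinuousLinearMap.mulLeftRight ℝ (Matrix n n ℂ) ((GaugeField.gaugeAct u U b : Matrix.specialUnitaryGroup n ℂ) : Matrix n n ℂ)
            ((GaugeField.gaugeAct u U b : Matrix.specialUnitaryGroup n ℂ) : Matrix n n ℂ)ᴴ) *
          (coordMat e (ContinuousLinearMap.mulLeftRight ℝ (Matrix n n ℂ) ((GaugeField.gaugeAct u U b : Matrix.specialUnitaryGroup n ℂ) : Matrix n n ℂ)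
            ((GaugeField.gaugeAct u U b : Matrix.specialUnitaryGroup n ℂ) : Matrix n n ℂ)ᴴ))ᵀ = 1 ∧
        (coordMat e (ContinuousLinearMap.mulLeftRight ℝ (Matrix n n ℂ) ((GaugeField.gaugeAct u U b : Matrix.specialUnitaryGroup n ℂ) : Matrix n n ℂ)
            ((GaugeField.gaugeAct u U b : Matrix.specialUnitaryGroup n ℂ) : Matrix n n ℂ)ᴴ))ᵀ *
          coordMat e (ContinuousLinearMap.mulLeftRight ℝ (Matrix n n ℂ) ((GaugeField.gaugeAct u U b : Matrix.specialUnitaryGroup n ℂ) : Matrix n n ℂ)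
            ((GaugeField.gaugeAct u U b : Matrix.specialUnitaryGroup n ℂ) : Matrix n n ℂ)ᴴ) = 1 ∧
        ∀ i i' : κ, (|(coordMat e (ContinuousLinearMap.mulLeftRight ℝ (Matrix n n ℂ) ((GaugeField.gaugeAct u U b : Matrix.specialUnitaryGroup n ℂ) : Matrix n n ℂ)
            ((GaugeField.gaugeAct u U b : Matrix.specialUnitaryGroup n ℂ) : Matrix n n ℂ)ᴴ) - 1) i i'| ≤ basisConst e * (2 * Fintype.card n) * (((P.d - 1 : ℕ) : ℝ) * N * δ)) :=
  ⟨axialGauge U lo hi, fun b hb =>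
    ⟨(uN_coordMat_conj_orthogonal e he (suN_coe_conjTranspose_mul_self (GaugeField.gaugeAct (axialGauge U lo hi) U b))).2,
      (uN_coordMat_conj_orthogonal e he (suN_coe_conjTranspose_mul_self (GaugeField.gaugeAct (axialGauge U lo hi) U b))).1,
      fun i i' => suN_transporterLetter_gaugeAct_axialGauge_of_mem_boxBonds e U hS₀ hU hδ hn hnN hb i i'⟩⟩

/-- **NON-VACUITY (A6) AT `SU(N)`**: the flat configuration is plaquette-small for every `δ > 0` (`plaqSmallOn_one`), so the junction fires there. [folklore] -/
theorem suN_exists_gauge_transporterLetter_one (he : ∀ A B : Matrix n n ℂ, traceForm A B = e A ⬝ᵥ e B) {lo hi : Fin P.d → ℤ} {δ : ℝ} (hδ : 0 < δ) {N : ℕ}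
    (hn : ∀ k, hi k ≤ lo k + N) (hnN : N < P.sitesPerDir j) :
    ∃ u : GaugeTransf P j (Matrix.specialUnitaryGroup n ℂ), ∀ b ∈ boxBonds lo hi,
      coordMat e (ContinuousLinearMap.mulLeftRight ℝ (Matrix n n ℂ) ((GaugeField.gaugeAct u (1 : GaugeField P j (Matrix.specialUnitaryGroup n ℂ)) b : Matrix.specialUnitaryGroup n ℂ) : Matrix n n ℂ)
            ((GaugeField.gaugeAct u (1 : GaugeField P j (Matrix.specialUnitaryGroup n ℂ)) b : Matrix.specialUnitaryGroup n ℂ) : Matrix n n ℂ)ᴴ) *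
          (coordMat e (ContinuousLinearMap.mulLeftRight ℝ (Matrix n n ℂ) ((GaugeField.gaugeAct u (1 : GaugeField P j (Matrix.specialUnitaryGroup n ℂ)) b : Matrix.specialUnitaryGroup n ℂ) : Matrix n n ℂ)
            ((GaugeField.gaugeAct u (1 : GaugeField P j (Matrix.specialUnitaryGroup n ℂ)) b : Matrix.specialUnitaryGroup n ℂ) : Matrix n n ℂ)ᴴ))ᵀ = 1 ∧
        (coordMat e (ContinuousLinearMap.mulLeftRight ℝ (Matrix n n ℂ) ((GaugeField.gaugeAct u (1 : GaugeField P j (Matrix.specialUnitaryGroup n ℂ)) b : Matrix.specialUnitaryGroup n ℂ) : Matrix n n ℂ)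
            ((GaugeField.gaugeAct u (1 : GaugeField P j (Matrix.specialUnitaryGroup n ℂ)) b : Matrix.specialUnitaryGroup n ℂ) : Matrix n n ℂ)ᴴ))ᵀ *
          coordMat e (ContinuousLinearMap.mulLeftRight ℝ (Matrix n n ℂ) ((GaugeField.gaugeAct u (1 : GaugeField P j (Matrix.specialUnitaryGroup n ℂ)) b : Matrix.specialUnitaryGroup n ℂ) : Matrix n n ℂ)
            ((GaugeField.gaugeAct u (1 : GaugeField P j (Matrix.specialUnitaryGroup n ℂ)) b : Matrix.specialUnitaryGroup n ℂ) : Matrix n n ℂ)ᴴ) = 1 ∧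
        ∀ i i' : κ, (|(coordMat e (ContinuousLinearMap.mulLeftRight ℝ (Matrix n n ℂ) ((GaugeField.gaugeAct u (1 : GaugeField P j (Matrix.specialUnitaryGroup n ℂ)) b : Matrix.specialUnitaryGroup n ℂ) : Matrix n n ℂ)
            ((GaugeField.gaugeAct u (1 : GaugeField P j (Matrix.specialUnitaryGroup n ℂ)) b : Matrix.specialUnitaryGroup n ℂ) : Matrix n n ℂ)ᴴ) - 1) i i'| ≤
          basisConst e * (2 * Fintype.card n) * (((P.d - 1 : ℕ) : ℝ) * N * δ)) :=
  suN_exists_gauge_transporterLetter_of_plaqSmallOn e he 1 (S₀ := boxPlaqs lo hi) subset_rfl (plaqSmallOn_one _ hδ) hδ.le hn hnN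

end Summit.QuantumFields.YangMills.BalabanUVNodes.N15.CurvedSpecies

end
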